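import Literature.MathematicalPhysics.QuantumLattice.BalabanRGHaarIterates
import Literature.MathematicalPhysics.QuantumLattice.LatticeGaugeDLRGibbsProofs
import Literature.MathematicalPhysics.QuantumLattice.GaugeGroups

/-!
# `IR` — stub `stub_rung_strong` PROVED: the tempered finite-size condition deep in the strong-coupling window

Spine route `BalabanLadder` (route-QuantumFields-BalabanLadder), crux `IR` (stmt-QuantumFields-19354),
BC3 skeleton `Cruxes/IR/Lines/birth.lean` (p2 g14 `IR_birth_tempered_p2.lean`, sha16 2fae84f69de8d29b), stub 3 =
the BC5 rung `stub_rung_strong` (P1 pack §5: `∀ |β| ≤ β_D, TemperedCond ρ β 1 1 ε 0`).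

**Statement (verbatim the registered stub).** For every compact group `G`, every continuous matrix representation
`ρ : G →* M_N(ℂ)` and every `ε > 0` there is `β_D > 0` such that for `|β| ≤ β_D` the TEMPERED finite-size condition
`TemperedCond ρ β 1 1 ε 0` holds: cell side `1`, window `1`, trivial tempered class (`T = univ`, `δ = 0`).

**Mechanism (high-temperature density ratio; folklore, Georgii 2011 Def. 2.9 / Prop. 8.8, Seiler LNP 159 Ch. 2).**
For a kernel region `Λ = regionEdges w Y` of a mesh-1 grid inside the window of radius 2, `#Λ ≤ 625·64` uniformly,
so the tilting density `exp(-β S_Λ)` of the Wilson DLR kernel lies in `[e^{-A}, e^{A}]` with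
`A = |β| (N + C_ρ) · #plaquettesTouching Λ ≤ |β| K(ρ)`.  The kernel expectation of a `[0,1]`-valued cylinder `f`
of the central cell is `(∫ F w_η dHaar^Λ)/(∫ w_η dHaar^Λ)` with `F(ζ) = f(ζ η_{Λᶜ})` INDEPENDENT of `η` (the central
cell lies in `Λ`), hence within `[e^{-2A} m, e^{2A} m]`, `m = ∫ F dHaar^Λ ∈ [0, 1]`, for EVERY exterior datum `η`;
two such expectations differ by at most `e^{2A} - e^{-2A} ≤ 8A ≤ ε` once `|β| ≤ min (1/(2K)) (ε/(8K))`.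
No cluster expansion, no Dobrushin matrix: the rung is the `β → 0` end of the Dobrushin ball, where the kernels
forget the boundary datum altogether.

**Measurability without second countability.** The stub quantifies over ALL compact `G` (no
`SecondCountableTopology G`, no injectivity of `ρ`), so `Continuous ⇒ Measurable` for the product σ-algebra on
`LGConfig 4 G` is not available; we push the plaquette holonomy through `ρ` into `M_N(ℂ)` (second countable, Borel)
with `map_mul`, where products are measurable (`measurable_wilsonBoundaryAction_of_continuous`), and re-derive the kernel
integral formula `integral_ymSpecification_of_continuous` (tree `integral_ymSpecification` minus its
`[SecondCountableTopology G]`).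

The four (data) definitions `cellEdges`, `windowCells`, `regionEdges`, `collarEdges` are the skeleton's, VERBATIM, in
the skeleton's namespace (the re-registered skeleton imports this module and drops its local copies; its Prop-valued
`TemperedCond` stays in the skeleton — no proposition is defined in this Theorems module); `stub_rung_strong_proved`
is the registered stub's statement with `TemperedCond ρ β 1 1 ε 0` δ-unfolded VERBATIM (`b = n = 1`, `δ = 0`), so the
registered stub closes by `exact stub_rung_strong_proved` (definitional unfolding only).  Everything here is proved (no `sorry`, no new axioms); nothing is asserted about
the weak-coupling regime, `TemperedCriterion` (stub_engine) or `IRTemperedCertificate` (stub_cert).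
Refs: Georgii2011 Def. 2.9, Ch. 8 (high-temperature uniqueness); SeilerLNP1982 Ch. 2 (Wilson DLR kernels);
Osterwalder–Seiler 1978 (strong-coupling expansion regime); folklore.
-/

set_option autoImplicit false

noncomputable section

open MeasureTheory
open Literature.MathematicalPhysics.QuantumFieldTheory Literature.MathematicalPhysics.QuantumLattice
open Literature.Probability.LatticeModels

namespace Summit.QuantumFields.YangMills.Cruxes.IR.Tempered

/-! ## §1 The definitions of the skeleton (verbatim) -/

section Defs

variable {G : Type} [Group G] [TopologicalSpace G] [IsTopologicalGroup G] [CompactSpace G]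
  [MeasurableSpace G] [BorelSpace G]

/-- Edges of the grid cell with index `y` (grid `w`: cell `y` is `∏ᵢ [w i (y i), w i (y i + 1))`). -/
def cellEdges (w : Fin 4 → ℤ → ℤ) (y : Fin 4 → ℤ) : Finset (Literature.MathematicalPhysics.QuantumLattice.ZdEdge 4) :=
  (Fintype.piFinset fun i : Fin 4 => Finset.Ico (w i (y i)) (w i (y i + 1))) ×ˢ (Finset.univ : Finset (Fin 4))

/-- The window of cell indices of radius `2n` around the central cell. -/
def windowCells (n : ℕ) : Finset (Fin 4 → ℤ) :=
  Fintype.piFinset fun _ : Fin 4 => Finset.Icc (-(2 * ((n : ℕ) : ℤ))) (2 * ((n : ℕ) : ℤ))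

/-- Edges of a set of cells. -/
def regionEdges (w : Fin 4 → ℤ → ℤ) (Y : Finset (Fin 4 → ℤ)) : Finset (Literature.MathematicalPhysics.QuantumLattice.ZdEdge 4) :=
  Y.biUnion (cellEdges w)

/-- The collar read by the kernel of region `Y`: window edges outside the region. -/
def collarEdges (w : Fin 4 → ℤ → ℤ) (n : ℕ) (Y : Finset (Fin 4 → ℤ)) : Finset (Literature.MathematicalPhysics.QuantumLattice.ZdEdge 4) :=
  regionEdges w (windowCells n) \ regionEdges w Y

end Defs

/-! ## §2 Counting: a mesh-1 kernel region inside the window of radius 2 has at most `625 · 64` edges -/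

section Counting

/-- A cell of a mesh-1 grid (sides in `[1, 2]`) has at most `2⁴ · 4 = 64` edges. -/
theorem card_cellEdges_le (w : Fin 4 → ℤ → ℤ)
    (hw : ∀ i j, w i j + ((1 : ℕ) : ℤ) ≤ w i (j + 1) ∧ w i (j + 1) ≤ w i j + 2 * ((1 : ℕ) : ℤ))
    (y : Fin 4 → ℤ) : (cellEdges w y).card ≤ 64 := by
  unfold cellEdges
  rw [Finset.card_product, Fintype.card_piFinset, Finset.card_univ, Fintype.card_fin]
  have h : ∀ i : Fin 4, (Finset.Ico (w i (y i)) (w i (y i + 1))).card ≤ 2 := fun i => by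
    rw [Int.card_Ico]
    refine Int.toNat_le.2 ?_
    have := (hw i (y i)).2
    push_cast at this ⊢
    omega
  have hp : (∏ i : Fin 4, (Finset.Ico (w i (y i)) (w i (y i + 1))).card) ≤ 2 ^ 4 := by
    have := Finset.prod_le_pow_card (Finset.univ : Finset (Fin 4))
      (fun i => (Finset.Ico (w i (y i)) (w i (y i + 1))).card) 2 fun i _ => h i
    simpa using this
  omega

/-- The window of radius `2` has `5⁴ = 625` cells. -/
theorem card_windowCells_one : (windowCells 1).card = 625 := by
  unfold windowCells
  rw [Fintype.card_piFinset, Finset.prod_const, Finset.card_univ, Fintype.card_fin, Int.card_Icc]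
  rfl

/-- A mesh-1 kernel region inside the window of radius `2` has at most `625 · 64 = 40000` edges. -/
theorem card_regionEdges_le (w : Fin 4 → ℤ → ℤ)
    (hw : ∀ i j, w i j + ((1 : ℕ) : ℤ) ≤ w i (j + 1) ∧ w i (j + 1) ≤ w i j + 2 * ((1 : ℕ) : ℤ))
    (Y : Finset (Fin 4 → ℤ)) (hY : Y ⊆ windowCells 1) : (regionEdges w Y).card ≤ 40000 := by
  unfold regionEdges
  have hYc : Y.card ≤ 625 := card_windowCells_one ▸ Finset.card_le_card hY
  calc (Y.biUnion (cellEdges w)).card ≤ ∑ y ∈ Y, (cellEdges w y).card := Finset.card_biUnion_le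
    _ ≤ Y.card • 64 := Finset.sum_le_card_nsmul _ _ _ fun y _ => card_cellEdges_le w hw y
    _ ≤ 625 * 64 := by rw [smul_eq_mul]; exact Nat.mul_le_mul_right _ hYc
    _ = 40000 := by norm_num

/-- The central cell lies in every kernel region containing the cell index `0`. -/
theorem cellEdges_subset_regionEdges (w : Fin 4 → ℤ → ℤ) {Y : Finset (Fin 4 → ℤ)}
    (h0 : (0 : Fin 4 → ℤ) ∈ Y) : cellEdges w 0 ⊆ regionEdges w Y :=
  Finset.subset_biUnion_of_mem (cellEdges w) h0

end Counting

/-! ## §3 Measurability of the Wilson weight without second countability, and the kernel integral formula -/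

section Measurability

variable {d N : ℕ} {G : Type*} [Group G] [TopologicalSpace G] [IsTopologicalGroup G]
  [MeasurableSpace G] [BorelSpace G] (ρ : G →* Matrix (Fin N) (Fin N) ℂ)

/-- The boundary Wilson action `S_Λ` of a continuous matrix representation `ρ` of a topological group with its Borel
σ-algebra is measurable for the PRODUCT σ-algebra on configurations — with no second-countability assumption on `G`
(the tree's `measurable_plaquetteObs` / `Continuous.measurable` route needs `SecondCountableTopology G`): each plaquette
holonomy is pushed through `ρ` (`map_mul`) into `M_N(ℂ)`, which is second countable, so the product of the four
measurable matrix-valued edge maps is measurable, and `S_Λ` is a finite sum of such plaquette terms. [folklore] -/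
theorem measurable_wilsonBoundaryAction_of_continuous (hρ : Continuous ρ)
    (Λ : Finset (Literature.MathematicalPhysics.QuantumLattice.ZdEdge d)) :
    Measurable (wilsonBoundaryAction (G := G) ρ Λ) := by
  letI : MeasurableSpace (Matrix (Fin N) (Fin N) ℂ) := borel _
  haveI : BorelSpace (Matrix (Fin N) (Fin N) ℂ) := ⟨rfl⟩
  haveI : SecondCountableTopology (Matrix (Fin N) (Fin N) ℂ) :=
    inferInstanceAs (SecondCountableTopology (Fin N → Fin N → ℂ))
  have hρm : Measurable ρ := hρ.measurable
  have h1 : ∀ e : Literature.MathematicalPhysics.QuantumLattice.ZdEdge d,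
      Measurable fun U : LGConfig d G => ρ (U e) :=
    fun e => hρm.comp (measurable_pi_apply e)
  have h2 : ∀ e : Literature.MathematicalPhysics.QuantumLattice.ZdEdge d,
      Measurable fun U : LGConfig d G => ρ ((U e)⁻¹) :=
    fun e => hρm.comp (measurable_pi_apply e).inv
  have htr : Measurable fun M : Matrix (Fin N) (Fin N) ℂ => (M.trace).re :=
    (Complex.continuous_re.comp (continuous_id.matrix_trace)).measurable
  have hpl : ∀ (x : Site d) (i j : Fin d), Measurable (plaquetteObs (G := G) ρ x i j) := by
    intro x i j
    have key : Measurable fun U : LGConfig d G =>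
        ((ρ (U (x, i)) * ρ (U (x + Pi.single i 1, j)) * ρ ((U (x + Pi.single j 1, i))⁻¹) *
          ρ ((U (x, j))⁻¹)).trace).re :=
      htr.comp ((((h1 _).mul (h1 _)).mul (h2 _)).mul (h2 _))
    convert key using 1
    funext U
    simp only [plaquetteObs, plaquetteHolonomyZd, map_mul]
  have : wilsonBoundaryAction (G := G) ρ Λ = fun U =>
      ∑ p ∈ plaquettesTouching Λ, ((N : ℝ) - plaquetteObs ρ p.1 p.2.1.1 p.2.1.2 U) := rfl
  rw [this]
  exact Finset.measurable_sum _ fun p _ => measurable_const.sub (hpl _ _ _)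

/-- The Wilson tilting weight `exp(-β S_Λ)` is measurable for the product σ-algebra. [folklore] -/
theorem measurable_wilsonWeight_of_continuous (hρ : Continuous ρ) (β : ℝ) (Λ : Finset (Literature.MathematicalPhysics.QuantumLattice.ZdEdge d)) :
    Measurable fun U : LGConfig d G => Real.exp (-β * wilsonBoundaryAction ρ Λ U) :=
  (measurable_const.mul (measurable_wilsonBoundaryAction_of_continuous ρ hρ Λ)).exp

variable [CompactSpace G]

/-- **Integral formula for the lattice Yang–Mills kernel** without second countability of `G`:
`∫ F dγ_Λ(· | η) = (∫ F(ζ η_{Λᶜ}) e^{-β S_Λ(ζ η_{Λᶜ})} dζ) / (∫ e^{-β S_Λ(ζ η_{Λᶜ})} dζ)`, the `ζ`-integrals over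
the product Haar measure on the edges of `Λ` (tree `integral_ymSpecification`, whose `[SecondCountableTopology G]`
is only used for the measurability supplied here by `measurable_wilsonWeight_of_continuous`)
(Georgii 2011, Def. 2.9; Seiler LNP 159 Ch. 2). [folklore] -/
theorem integral_ymSpecification_of_continuous (hρ : Continuous ρ) (β : ℝ) (Λ : Finset (Literature.MathematicalPhysics.QuantumLattice.ZdEdge d))
    {F : LGConfig d G → ℝ} (hF : Measurable F) (η : LGConfig d G) :
    ∫ U, F U ∂(ymSpecification ρ β Λ η) =
      (∫ ζ, F (glueWith Λ ζ η) * Real.exp (-β * wilsonBoundaryAction ρ Λ (glueWith Λ ζ η))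
          ∂(Measure.pi fun _ : ↥Λ => haarProbability G)) /
        ∫ ζ, Real.exp (-β * wilsonBoundaryAction ρ Λ (glueWith Λ ζ η))
          ∂(Measure.pi fun _ : ↥Λ => haarProbability G) := by
  have hg : Measurable (glueWith Λ · η) := measurable_glueWith Λ η
  have hw : Measurable fun U : LGConfig d G => Real.exp (-β * wilsonBoundaryAction ρ Λ U) :=
    measurable_wilsonWeight_of_continuous ρ hρ β Λ
  unfold ymSpecification
  rw [integral_tilted, integral_map hg.aemeasurable hw.aestronglyMeasurable,
    integral_map hg.aemeasurable]
  · simp only [smul_eq_mul]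
    rw [← integral_div]
    refine congrArg _ (funext fun ζ => ?_)
    ring
  · exact ((hw.div_const _).mul hF).aestronglyMeasurable

end Measurability

/-! ## §4 The density-ratio estimate -/

section Ratio

/-- **Density-ratio bounds.** For a probability measure `π`, a `[0,1]`-valued measurable `F` and a measurable
weight `w` with `e^{-A} ≤ w ≤ e^{A}`: `e^{-2A} ∫F ≤ (∫ F w)/(∫ w) ≤ e^{2A} ∫F`. [folklore] -/
theorem ratio_bounds {X : Type*} [MeasurableSpace X] (π : Measure X) [IsProbabilityMeasure π]
    {F w : X → ℝ} (hFm : Measurable F) (hF : ∀ x, 0 ≤ F x ∧ F x ≤ 1) (hwm : Measurable w)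
    {A : ℝ} (hw : ∀ x, Real.exp (-A) ≤ w x ∧ w x ≤ Real.exp A) :
    Real.exp (-(2 * A)) * (∫ x, F x ∂π) ≤ (∫ x, F x * w x ∂π) / (∫ x, w x ∂π) ∧
      (∫ x, F x * w x ∂π) / (∫ x, w x ∂π) ≤ Real.exp (2 * A) * ∫ x, F x ∂π := by
  have hFi : Integrable F π :=
    Literature.MathematicalPhysics.QuantumLattice.integrable_of_bound hFm.aestronglyMeasurable (C := 1) fun x => by
      rw [abs_le]; exact ⟨by linarith [(hF x).1], (hF x).2⟩
  have hwpos : ∀ x, 0 < w x := fun x => (Real.exp_pos _).trans_le (hw x).1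
  have hwi : Integrable w π :=
    Literature.MathematicalPhysics.QuantumLattice.integrable_of_bound hwm.aestronglyMeasurable (C := Real.exp A) fun x => by
      rw [abs_of_pos (hwpos x)]; exact (hw x).2
  have hFwi : Integrable (fun x => F x * w x) π :=
    Literature.MathematicalPhysics.QuantumLattice.integrable_of_bound (hFm.mul hwm).aestronglyMeasurable (C := Real.exp A) fun x => by
      rw [abs_mul, abs_of_nonneg (hF x).1, abs_of_pos (hwpos x)]
      calc F x * w x ≤ 1 * Real.exp A := mul_le_mul (hF x).2 (hw x).2 (hwpos x).le zero_le_one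
        _ = Real.exp A := one_mul _
  set m := ∫ x, F x ∂π with hm
  set Z := ∫ x, w x ∂π with hZ
  set Nm := ∫ x, F x * w x ∂π with hNm
  have hm0 : 0 ≤ m := integral_nonneg fun x => (hF x).1
  have hZlo : Real.exp (-A) ≤ Z := by
    have h := integral_mono (integrable_const (Real.exp (-A))) hwi fun x => (hw x).1
    simpa using h
  have hZhi : Z ≤ Real.exp A := by
    have h := integral_mono hwi (integrable_const (Real.exp A)) fun x => (hw x).2
    simpa using h
  have hZpos : 0 < Z := (Real.exp_pos _).trans_le hZlo
  have hNlo : Real.exp (-A) * m ≤ Nm := by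
    have h := integral_mono (hFi.mul_const (Real.exp (-A))) hFwi fun x =>
      mul_le_mul_of_nonneg_left (hw x).1 (hF x).1
    rw [integral_mul_const] at h
    simpa [mul_comm] using h
  have hNhi : Nm ≤ Real.exp A * m := by
    have h := integral_mono hFwi (hFi.mul_const (Real.exp A)) fun x =>
      mul_le_mul_of_nonneg_left (hw x).2 (hF x).1
    rw [integral_mul_const] at h
    simpa [mul_comm] using h
  have hee : Real.exp (-(2 * A)) * Real.exp A = Real.exp (-A) := by
    rw [← Real.exp_add]; congr 1; ring
  have hee' : Real.exp (2 * A) * Real.exp (-A) = Real.exp A := by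
    rw [← Real.exp_add]; congr 1; ring
  constructor
  · rw [le_div_iff₀ hZpos]
    calc Real.exp (-(2 * A)) * m * Z ≤ Real.exp (-(2 * A)) * m * Real.exp A :=
          mul_le_mul_of_nonneg_left hZhi (mul_nonneg (Real.exp_pos _).le hm0)
      _ = Real.exp (-A) * m := by rw [mul_right_comm, hee]
      _ ≤ Nm := hNlo
  · rw [div_le_iff₀ hZpos]
    calc Nm ≤ Real.exp A * m := hNhi
      _ = Real.exp (2 * A) * m * Real.exp (-A) := by rw [mul_right_comm, hee']
      _ ≤ Real.exp (2 * A) * m * Z :=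
          mul_le_mul_of_nonneg_left hZlo (mul_nonneg (Real.exp_pos _).le hm0)

/-- `e^{2A} - e^{-2A} ≤ 8A` for `0 ≤ A ≤ 1/2` (from `|e^x - 1| ≤ 2|x|` on `|x| ≤ 1`). [folklore] -/
theorem exp_gap_le {A : ℝ} (hA0 : 0 ≤ A) (hA : 2 * A ≤ 1) :
    Real.exp (2 * A) - Real.exp (-(2 * A)) ≤ 8 * A := by
  have habs : |2 * A| = 2 * A := abs_of_nonneg (by linarith)
  have h1 : |2 * A| ≤ 1 := by rw [habs]; exact hA
  have h2 : |-(2 * A)| ≤ 1 := by rw [abs_neg]; exact h1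
  have e1 := Real.abs_exp_sub_one_le h1
  have e2 := Real.abs_exp_sub_one_le h2
  rw [habs] at e1
  rw [abs_neg, habs] at e2
  rw [abs_le] at e1 e2
  linarith [e1.2, e2.1]

/-- Two numbers in the band `[L m, U m]` differ by at most `(U - L) m`. [folklore] -/
theorem abs_sub_le_of_bounds {L U m ε I₁ I₂ : ℝ} (h₁ : L * m ≤ I₁) (h₂ : I₁ ≤ U * m) (h₃ : L * m ≤ I₂)
    (h₄ : I₂ ≤ U * m) (h₅ : (U - L) * m ≤ ε) : |I₁ - I₂| ≤ ε := by
  rw [abs_le]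
  constructor <;> linarith [sub_mul U L m]

end Ratio

/-! ## §5 The rung -/

/-- **STUB 3 `stub_rung_strong` of the `IR` skeleton — PROVED** (statement = the stub's with
`TemperedCond ρ β 1 1 ε 0` unfolded verbatim; close the registered stub by
`exact Summit.QuantumFields.YangMills.Cruxes.IR.Tempered.stub_rung_strong_proved`): deep in the strong-coupling
window the Wilson DLR kernels of every mesh-1 kernel region inside the window of radius 2 forget their exterior
datum up to `ε`, so the tempered finite-size condition holds at `(b, n, δ) = (1, 1, 0)` with the trivial tempered
class `T = univ`. [folklore] -/
theorem stub_rung_strong_proved :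
    ∀ (G : Type) [Group G] [TopologicalSpace G] [IsTopologicalGroup G] [CompactSpace G]
      [MeasurableSpace G] [BorelSpace G] (N : ℕ) (ρ : G →* Matrix (Fin N) (Fin N) ℂ), Continuous ρ →
      ∀ ε : ℝ, 0 < ε → ∃ β_D : ℝ, 0 < β_D ∧ ∀ β : ℝ, |β| ≤ β_D →
        ∀ w : Fin 4 → ℤ → ℤ,
          (∀ i j, w i j + ((1 : ℕ) : ℤ) ≤ w i (j + 1) ∧ w i (j + 1) ≤ w i j + 2 * ((1 : ℕ) : ℤ)) →
          ∀ Y : Finset (Fin 4 → ℤ), Y ⊆ windowCells 1 → (0 : Fin 4 → ℤ) ∈ Y →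
            ∃ T : Set (LGConfig 4 G), MeasurableSet T ∧
              (∀ η η' : LGConfig 4 G, η ∈ T → η' ∈ T →
                (∀ e ∈ regionEdges w (windowCells 1), η e = η' e) →
                ∀ f : LGConfig 4 G → ℝ, IsCylinder f (cellEdges w 0) → Measurable f →
                  (∀ U, 0 ≤ f U ∧ f U ≤ 1) →
                  |(∫ U, f U ∂(ymSpecification ρ β (regionEdges w Y) η)) -
                    ∫ U, f U ∂(ymSpecification ρ β (regionEdges w Y) η')| ≤ ε) ∧
              (∀ E' : Finset (Literature.MathematicalPhysics.QuantumLattice.ZdEdge 4),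
                collarEdges w 1 Y ⊆ E' → ∀ ζ : LGConfig 4 G,
                  (ymSpecification ρ β E' ζ) Tᶜ ≤ ENNReal.ofReal 0) := by
  intro G _ _ _ _ _ _ N ρ hρ ε hε
  obtain ⟨C, hC0, hC⟩ := Literature.MathematicalPhysics.QuantumLattice.exists_forall_abs_plaquetteObs_le (d := 4) ρ hρ
  -- uniform bound on the number of plaquettes touching an admissible kernel region
  set P : ℕ := (1 + 4) * Fintype.card {p : Fin 4 × Fin 4 // p.1 < p.2} * 40000 with hP
  set K : ℝ := ((N : ℝ) + C) * P + 1 with hK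
  have hNC : 0 ≤ (N : ℝ) + C := by positivity
  have hKpos : 0 < K := by positivity
  refine ⟨min (1 / (2 * K)) (ε / (8 * K)), lt_min (by positivity) (by positivity), fun β hβ => ?_⟩
  have hβ1 : |β| ≤ 1 / (2 * K) := hβ.trans (min_le_left _ _)
  have hβ2 : |β| ≤ ε / (8 * K) := hβ.trans (min_le_right _ _)
  intro w hw Y hY h0Y
  refine ⟨Set.univ, MeasurableSet.univ, ?_, ?_⟩
  · intro η η' _ _ _ f hf_cyl hfm hf01
    set Λ : Finset (Literature.MathematicalPhysics.QuantumLattice.ZdEdge 4) := regionEdges w Y with hΛ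
    -- the constant `A` and its smallness
    have hcardΛ : Λ.card ≤ 40000 := card_regionEdges_le w hw Y hY
    have hcardP : (plaquettesTouching Λ).card ≤ P :=
      (Literature.MathematicalPhysics.QuantumLattice.card_plaquettesTouching_le Λ).trans (Nat.mul_le_mul_left _ hcardΛ)
    set A : ℝ := |β| * (((N : ℝ) + C) * (plaquettesTouching Λ).card) with hA
    have hA0 : 0 ≤ A := by positivity
    have hAK : A ≤ |β| * K := by
      refine mul_le_mul_of_nonneg_left ?_ (abs_nonneg β)
      have : ((N : ℝ) + C) * (plaquettesTouching Λ).card ≤ ((N : ℝ) + C) * P :=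
        mul_le_mul_of_nonneg_left (by exact_mod_cast hcardP) hNC
      linarith
    have hβK1 : |β| * K ≤ 1 / 2 := by
      calc |β| * K ≤ 1 / (2 * K) * K := mul_le_mul_of_nonneg_right hβ1 hKpos.le
        _ = 1 / 2 := by field_simp
    have hβK2 : |β| * K ≤ ε / 8 := by
      calc |β| * K ≤ ε / (8 * K) * K := mul_le_mul_of_nonneg_right hβ2 hKpos.le
        _ = ε / 8 := by field_simp
    have h2A : 2 * A ≤ 1 := by linarith
    have h8A : 8 * A ≤ ε := by linarith
    -- the weight and its two-sided bound
    have hwt : ∀ U : LGConfig 4 G, Real.exp (-A) ≤ Real.exp (-β * wilsonBoundaryAction ρ Λ U) ∧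
        Real.exp (-β * wilsonBoundaryAction ρ Λ U) ≤ Real.exp A := by
      intro U
      have hS := Literature.MathematicalPhysics.QuantumLattice.abs_wilsonBoundaryAction_le ρ hC Λ U
      have hb : |-β * wilsonBoundaryAction ρ Λ U| ≤ A := by
        rw [abs_mul, abs_neg]
        exact mul_le_mul_of_nonneg_left hS (abs_nonneg β)
      rw [abs_le] at hb
      exact ⟨Real.exp_le_exp.2 hb.1, Real.exp_le_exp.2 hb.2⟩
    have hwm : ∀ ξ : LGConfig 4 G, Measurable fun ζ : ↥Λ → G =>
        Real.exp (-β * wilsonBoundaryAction ρ Λ (glueWith Λ ζ ξ)) := fun ξ =>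
      (measurable_wilsonWeight_of_continuous ρ hρ β Λ).comp (measurable_glueWith Λ ξ)
    -- the kernel expectations as density ratios over the product Haar measure
    set π : Measure (↥Λ → G) := Measure.pi fun _ : ↥Λ => haarProbability G with hπ
    haveI : IsProbabilityMeasure π := by rw [hπ]; infer_instance
    rw [integral_ymSpecification_of_continuous ρ hρ β Λ hfm η,
      integral_ymSpecification_of_continuous ρ hρ β Λ hfm η']
    -- `F(ζ) = f (ζ η_{Λᶜ})` does not depend on the exterior datum: the central cell lies in `Λ`
    have hSΛ : cellEdges w 0 ⊆ Λ := cellEdges_subset_regionEdges w h0Y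
    have hFeq : ∀ ζ : ↥Λ → G, f (glueWith Λ ζ η') = f (glueWith Λ ζ η) := fun ζ =>
      hf_cyl fun e he => by
        have heΛ : e ∈ Λ := hSΛ (Finset.mem_coe.1 he)
        rw [glueWith_apply_mem _ _ _ heΛ, glueWith_apply_mem _ _ _ heΛ]
    have hNum' : (∫ ζ, f (glueWith Λ ζ η') * Real.exp (-β * wilsonBoundaryAction ρ Λ (glueWith Λ ζ η')) ∂π) =
        ∫ ζ, f (glueWith Λ ζ η) * Real.exp (-β * wilsonBoundaryAction ρ Λ (glueWith Λ ζ η')) ∂π :=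
      integral_congr_ae (Filter.Eventually.of_forall fun ζ => by simp only [hFeq])
    rw [hNum']
    have hFm : Measurable fun ζ : ↥Λ → G => f (glueWith Λ ζ η) := hfm.comp (measurable_glueWith Λ η)
    have hF01 : ∀ ζ : ↥Λ → G, 0 ≤ f (glueWith Λ ζ η) ∧ f (glueWith Λ ζ η) ≤ 1 := fun ζ => hf01 _
    obtain ⟨hlo, hhi⟩ := ratio_bounds π hFm hF01 (hwm η) (A := A) fun ζ => hwt _
    obtain ⟨hlo', hhi'⟩ := ratio_bounds π hFm hF01 (hwm η') (A := A) fun ζ => hwt _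
    -- `m = ∫ F dπ ∈ [0, 1]`
    set m := ∫ ζ, f (glueWith Λ ζ η) ∂π with hm
    have hm0 : 0 ≤ m := integral_nonneg fun ζ => (hF01 ζ).1
    have hm1 : m ≤ 1 := by
      have hFi : Integrable (fun ζ : ↥Λ → G => f (glueWith Λ ζ η)) π :=
        Literature.MathematicalPhysics.QuantumLattice.integrable_of_bound hFm.aestronglyMeasurable (C := 1) fun ζ => by
          rw [abs_le]; exact ⟨by linarith [(hF01 ζ).1], (hF01 ζ).2⟩
      have h := integral_mono hFi (integrable_const (1 : ℝ)) fun ζ => (hF01 ζ).2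
      simpa using h
    have hUL : 0 ≤ Real.exp (2 * A) - Real.exp (-(2 * A)) :=
      sub_nonneg.2 (Real.exp_le_exp.2 (by linarith))
    have hgap : Real.exp (2 * A) - Real.exp (-(2 * A)) ≤ 8 * A := exp_gap_le hA0 h2A
    have hspan : (Real.exp (2 * A) - Real.exp (-(2 * A))) * m ≤ ε :=
      calc (Real.exp (2 * A) - Real.exp (-(2 * A))) * m
            ≤ (Real.exp (2 * A) - Real.exp (-(2 * A))) * 1 := mul_le_mul_of_nonneg_left hm1 hUL
        _ ≤ ε := by rw [mul_one]; exact hgap.trans h8A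
    exact abs_sub_le_of_bounds hlo hhi hlo' hhi' hspan
  · intro E' _ ζ
    simp only [Set.compl_univ, measure_empty, zero_le]

end Summit.QuantumFields.YangMills.Cruxes.IR.Tempered
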